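import Summits.QuantumFields.BalabanUV.T4Continuum.Support.ShellMeasurePlaquetteCubicLocated
import Summits.QuantumFields.BalabanUV.T4Continuum.Support.ShellMeasurePinnedProp4

/-!
# `T4Continuum.ShellMeasurePlaquetteCubicLocatedPinned` — row S77 file 2∕2: THE LEVEL-0 INSTANCE — S75's `hquad`
# LITERALLY for OUR one-grid action on the flat base, and `ShellMeasurePinnedProp4.prop4Hyp_pinned` FIRED on it
(cell `pub-balaban`, sub-cell `t4`, spine estimate NE7c (node U5b), crew lineage `b2b-balaban-t4-ne7c-formalise-leaf-02` gen 8;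
owner table `LEAVES-NE7c-P1.md` row S77 (GO l.17266: «a flat one-grid version … acceptable ONLY as the level-0 instance»);
imports S77 file 1 `ShellMeasurePlaquetteCubicLocated` and the owner's S75 `ShellMeasurePinnedProp4` (p225698) ONLY;
[folklore]; 0 sorry, 0 def)

HONEST FRAMING.  Finite four-torus programme, rung (B)+1 only — NOT infinite volume, NOT a mass gap, NOT the Clay
problem, NOT summit progress; (B), `BetaPertHyp`, (B^μ) are not consumed.  NE7c (`T4IndicatorShell.ShellWeightBound`)
is NOT PRINTED and NOT PROVED; «NE7c ⇐ the named binders» (WALL `t4/b2b-balaban-t4-ne7c-p1/WALL-NE7c-P1.md` §2).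
ELEMENTARY bookkeeping ([folklore]); [Balaban1985Variational] (39)∕(97)∕(98) are LOCATORS for the shape only — the
paper is under adjudication; nothing printed is asserted or cited as a fact; no `def` is minted.
HONEST DEPENDENCY (cell): continuum YM on T⁴ ⇐ BetaPertH ∧ nine spine estimates (0/9 proved); BetaPertH ⇐ (D1) ∧ (D4)
∧ CAP+tail; G-an2-4 gates asym, D1 and NE2/3/4.

THE POINT.  File 1 gave row S77's END at the live levels in the `WMax` currency (η-free kernel; consumed by the owner's
announced S75 f2 `prop4Hyp_pinned_weighted`).  At LEVEL 0 (one grid, unit weights) the owner's S75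
`prop4Hyp_pinned` as it stands takes a FLAT located majorant `‖W A c‖ ≤ ‖A‖·Σ_b k c b·‖A b‖` on the flat ball; THIS FILE
supplies it for OUR one-grid Wilson action and fires S75:
* **`located_quad_ord₃_oneGrid`**: for `‖A‖ < ε∕2` and every bond `c`,
  `‖locGrad (Σ_{p∈Pl} ord₃ (plaqFunSym τ U (bd p))) A c‖ ≤ ‖A‖·Σ_b k₀ c b·‖A b‖`,
  `k₀ c b = 72(d−1)·η·‖τ‖·‖Dv‖·[b.1.1 ∈ nbhdSites c.1.1 c.1.2] + 8κ·#{p ∈ Pl : c ∈ bonds (bd p) ∧ b ∈ bonds (bd p)}`,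
  `κ = ‖τ‖(248∕3·ε₀ + 40∕3·ε)` — the ∇-size bounded through the OPERATOR NORM `‖Dv‖` of the ∇-datum (for `covD` of
  order `η⁻¹`: the explicit `η⁻¹` the owner allows at level 0 ONLY; with the one-grid weight `iη∕2` the product is O(1));
* **`prop4Hyp_pinned_ord₃_oneGrid`**: given the pin geometry `(ρ, posIn, posOut, ϖ, δ′)` and a row-sum bound
  `Σ_b k₀ c b·e^{δ′ρ(posOut c, posIn b)} ≤ M` (DISPLAYED data of S75∕[dict]), S75's `prop4Hyp_pinned` FIRES:
  `Prop4Hyp (W_pin) M (ε∕2)` for `W A := locGrad (Σ_p ord₃ plaqFunSym_p) A` read between the pinned spaces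
  `WSup (pinW δ′ (ϖ∘posIn)) 1 𝔸 → WSup (pinW δ′ (ϖ∘posOut)) 1 (𝔸 →L[ℂ] ℂ)` — S70 f4's pinned `hW` INHABITED at level 0
  by OUR action (every other hypothesis geometric∕displayed as in f5d-b).
NOT HERE: the live-level pinned END (file 1 + S75 f2, owner); no estimate of Bałaban's is discharged.
-/

noncomputable section

open scoped BigOperators

namespace Summit.QuantumFields.BalabanUV.T4Continuum.ShellMeasurePlaquetteCubicLocatedPinned

open Literature.MathematicalPhysics.QuantumFieldTheory.Balaban1983to89
open B7Prop1Explicit (e U1 mem_U1)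
open B8Ineq132 (covDerivFwd)
open B11Prop6Scheme (Prop4Hyp)
open ShellMeasureWilsonGradientTail (plaqWord bonds)
open ShellMeasurePlaquetteTwist (plaqFunSym analyticAt_plaqFunSym)
open ShellMeasurePlaquetteCubicLocal (analyticAt_ord₃)
open ShellMeasureLocalGradientTailJet (ord₃)
open Summit.QuantumFields.BalabanUV.T4Continuum.ShellMeasureCommutatorVariation (plaqStar)
open Summit.QuantumFields.BalabanUV.T4Continuum.ShellMeasureCommutatorGradientLocal
  (baseSites nbhdSites mem_baseSites_self norm_sum_dcub_bump_le_local)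
open Summit.QuantumFields.BalabanUV.T4Continuum.ShellMeasureCommutatorLocGrad (ext cubT)
open Summit.QuantumFields.BalabanUV.T4Continuum.ShellMeasureLocalGradientTail (locGrad)
open Summit.QuantumFields.BalabanUV.T4Continuum.ShellMeasureGradientTailLevels (differentiableOn_locGrad_of_analyticOnNhd)
open Summit.QuantumFields.BalabanUV.T4Continuum.ShellMeasureMultiGridNorms (WSup)
open Summit.QuantumFields.BalabanUV.T4Continuum.ShellMeasurePinnedNorm (pinW)
open Summit.QuantumFields.BalabanUV.T4Continuum.ShellMeasurePinnedProp4 (prop4Hyp_pinned)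
open Summit.QuantumFields.BalabanUV.T4Continuum.ShellMeasurePlaquetteCubicDictionary (V0remCov)
open Summit.QuantumFields.BalabanUV.T4Continuum.ShellMeasurePlaquetteCubicCovBinders
  (hcub_V0remCov V0remCov_add_single analyticOnNhd_V0remCov)
open Summit.QuantumFields.BalabanUV.T4Continuum.ShellMeasurePlaquetteCubicAssembly
  (restr_unit_bounded locGrad_sum_ord₃_eq norm_I_mul_div_two)
open Summit.QuantumFields.BalabanUV.T4Continuum.ShellMeasurePlaquetteCubicLocated
  (sum_filter_sum_eq_sum_card weighted_locGrad_le_located norm_ext_le_sum_nbhd)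

export B7Prop1Explicit (Site)

variable {d : ℕ} {𝔸 : Type*} [NormedRing 𝔸] [NormOneClass 𝔸] [NormedAlgebra ℂ 𝔸] [CompleteSpace 𝔸]
  (Λ : Finset (Site d × Fin d)) (Pl : Finset (Fin d × Fin d × Site d)) (τ : 𝔸 →L[ℂ] ℂ)
  {U₀ : Site d → Fin d → 𝔸ˣ} (h₀ : ∀ y κ, U₀ y κ ∈ U1 𝔸) (bd : Fin d × Fin d × Site d → (Fin 4 → ↥Λ × Bool))
include h₀

/-! ## §4 Level 0: the flat located majorant of OUR one-grid action's gradient -/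

omit [CompleteSpace 𝔸] in
/-- THE `∇`-PART, FLAT AND LOCATED: `‖locGrad (cubT Λ Pl w τ η U₀) A c‖ ≤ 144(d−1)‖w‖‖τ‖·‖Dv‖·‖A‖·Σ_{b : b.1.1 ∈ nbhdSites c}‖A b‖`
for any ∇-datum `Dv` dominating the covariant derivatives of the extended field (leaf-05's f3d with the local field size
as a located sum and the derivative size through `‖Dv A‖ ≤ ‖Dv‖·‖A‖`). [folklore] -/
theorem norm_locGrad_cubT_le_located_flat (w : ℂ) {η : ℝ} (hη : 0 < η) (htr : ∀ P Q : 𝔸, τ (P * Q) = τ (Q * P))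
    (hincr : ∀ p ∈ Pl, p.1 < p.2.1) {c : ↥Λ} (hst : plaqStar c.1.1 c.1.2 ⊆ Pl)
    {I : Type*} [Fintype I] (Dv : (↥Λ → 𝔸) →L[ℂ] (I → 𝔸))
    (hDv : ∀ (A : ↥Λ → 𝔸) (y : Site d) (κ τ' : Fin d), ‖covDerivFwd η U₀ κ (fun z => ext Λ A z τ') y‖ ≤ ‖Dv A‖)
    (A : ↥Λ → 𝔸) :
    ‖locGrad (cubT Λ Pl w τ η U₀) A c‖ ≤ 144 * ((d : ℝ) - 1) * ‖w‖ * ‖τ‖ * ‖Dv‖ * ‖A‖ *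
      ∑ b ∈ Finset.univ.filter (fun b : ↥Λ => b.1.1 ∈ nbhdSites c.1.1 c.1.2), ‖A b‖ := by
  have hd : 0 ≤ (d : ℝ) - 1 := by
    have : 1 ≤ d := Nat.succ_le_of_lt (Fin.pos c.1.2)
    have : (1 : ℝ) ≤ d := by exact_mod_cast this
    linarith
  set a := ∑ b ∈ Finset.univ.filter (fun b : ↥Λ => b.1.1 ∈ nbhdSites c.1.1 c.1.2), ‖A b‖ with ha_def
  have ha0 : 0 ≤ a := Finset.sum_nonneg fun b _ => norm_nonneg _
  have hB : ∀ (x : Site d) (μ : Fin d), x ∈ nbhdSites c.1.1 c.1.2 → ‖ext Λ A x μ‖ ≤ a :=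
    fun x μ hx => norm_ext_le_sum_nbhd Λ A c hx μ
  have hG : ∀ (x : Site d) (κ' τ' : Fin d), x ∈ baseSites c.1.1 →
      ‖covDerivFwd η U₀ κ' (fun z => ext Λ A z τ') x‖ ≤ ‖Dv‖ * ‖A‖ :=
    fun x κ' τ' _ => (hDv A x κ' τ').trans (Dv.le_opNorm A)
  have hDA : 0 ≤ ‖Dv‖ * ‖A‖ := by positivity
  have h : ‖locGrad (cubT Λ Pl w τ η U₀) A c‖ ≤ 144 * ((d : ℝ) - 1) * ‖w‖ * ‖τ‖ * a * (‖Dv‖ * ‖A‖) :=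
    ShellMeasureCommutatorLocGrad.norm_locGrad_cubT_le Λ Pl w τ η U₀ A c (by positivity) fun X =>
      norm_sum_dcub_bump_le_local hη h₀ hB hG w htr hst hincr X
  calc _ ≤ _ := h
    _ = _ := by ring

/-- **ROW S77 AT LEVEL 0 — S75's `hquad` LITERALLY FOR OUR ONE-GRID ACTION.**  Hypotheses as in f5d-b
`prop4Hyp_locGrad_ord₃_oneGrid` (`Pl` finite increasing ⊇ stars, `bd p = ∂p` oriented `(+,+,−,−)`, `U₀` ∈ `U1` with
`‖U₀(∂p) − 1‖ ≤ ε₀` on `Pl`, τ tracial, `η > 0`, `0 < ε`, `4ε ≤ 1`, `0 ≤ ε₀`, a ∇-datum `Dv` with flat domination);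
conclusion: for every flat field `A` with `‖A‖ < ε∕2` and every bond `c`,
`‖locGrad (Σ_{p∈Pl} ord₃ (plaqFunSym τ U (bd p))) A c‖ ≤ ‖A‖·Σ_b k₀ c b·‖A b‖`,
`k₀ c b = 72(d−1)·η·‖τ‖·‖Dv‖·[b.1.1 ∈ nbhdSites c.1.1 c.1.2] + 8κ·#{p ∈ Pl : c ∈ bonds (bd p) ∧ b ∈ bonds (bd p)}`,
`κ = ‖τ‖(248∕3·ε₀ + 40∕3·ε)` — a LOCATED QUADRATIC MAJORANT ((98) TYPE, located form; nothing printed asserted).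
[folklore] -/
theorem located_quad_ord₃_oneGrid {η : ℝ} (hη : 0 < η) (htr : ∀ P Q : 𝔸, τ (P * Q) = τ (Q * P))
    (hincr : ∀ p ∈ Pl, p.1 < p.2.1) (hst : ∀ b : ↥Λ, plaqStar b.1.1 b.1.2 ⊆ Pl)
    (hbd : ∀ p ∈ Pl, ((bd p 0).1 : Site d × Fin d) = (p.2.2, p.1) ∧ ((bd p 1).1 : Site d × Fin d) = (p.2.2 + e p.1, p.2.1)
      ∧ ((bd p 2).1 : Site d × Fin d) = (p.2.2 + e p.2.1, p.1) ∧ ((bd p 3).1 : Site d × Fin d) = (p.2.2, p.2.1))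
    (hor : ∀ p ∈ Pl, (bd p 0).2 = true ∧ (bd p 1).2 = true ∧ (bd p 2).2 = false ∧ (bd p 3).2 = false)
    {I : Type*} [Fintype I] (Dv : (↥Λ → 𝔸) →L[ℂ] (I → 𝔸))
    (hDv : ∀ (A : ↥Λ → 𝔸) (y : Site d) (κ τ' : Fin d), ‖covDerivFwd η U₀ κ (fun z => ext Λ A z τ') y‖ ≤ ‖Dv A‖)
    {ε₀ ε : ℝ} (hε : 0 < ε) (hε4 : 4 * ε ≤ 1) (hε₀0 : 0 ≤ ε₀)
    (hε₀ : ∀ p ∈ Pl, ‖(plaqWord (fun b : ↥Λ => U₀ b.1.1 b.1.2) (bd p) (0 : ↥Λ → 𝔸) : 𝔸) - 1‖ ≤ ε₀)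
    (A : ↥Λ → 𝔸) (hA : ‖A‖ < ε / 2) (c : ↥Λ) :
    ‖locGrad (fun A => ∑ p ∈ Pl, ord₃ (plaqFunSym τ (fun b : ↥Λ => U₀ b.1.1 b.1.2) (bd p)) A) A c‖ ≤
      ‖A‖ * ∑ b : ↥Λ,
        (72 * ((d : ℝ) - 1) * η * ‖τ‖ * ‖Dv‖ * (if b.1.1 ∈ nbhdSites c.1.1 c.1.2 then 1 else 0)
          + 8 * (‖τ‖ * (248 / 3 * ε₀ + 40 / 3 * ε)) *
            ((Pl.filter (fun p => c ∈ bonds (bd p) ∧ b ∈ bonds (bd p))).card : ℝ)) * ‖A b‖ := by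
  obtain ⟨hU, hU'⟩ := restr_unit_bounded Λ h₀
  have hA0 : 0 ≤ ‖A‖ := norm_nonneg _
  rw [locGrad_sum_ord₃_eq Λ Pl τ h₀ bd htr hη.ne' hbd, Pi.add_apply]
  -- the `∇`-part
  have hgrad := norm_locGrad_cubT_le_located_flat Λ Pl τ h₀ (Complex.I * η / 2) hη htr hincr (hst c) Dv hDv A
  rw [norm_I_mul_div_two hη] at hgrad
  -- the `∇`-free part: file 1's located (97) at unit weights
  have hκ : 0 ≤ ‖τ‖ * (248 / 3 * ε₀ + 40 / 3 * ε) := by positivity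
  have hfree := weighted_locGrad_le_located Pl (fun p => V0remCov τ (fun b : ↥Λ => U₀ b.1.1 b.1.2) (bd p))
    (fun p => bonds (bd p)) (fun _ : ↥Λ => (1 : ℝ)) (fun _ => (1 : ℝ)) hκ le_rfl (fun _ => one_pos)
    (fun _ _ => one_pos) (fun _ _ _ _ => le_rfl) (fun _ _ _ _ => by simp)
    (fun p _ => (analyticOnNhd_V0remCov τ (bd p) hU hU' _).differentiableOn)
    (fun p hp B σ hσ0 hσ hB => by
      have hσ' : σ < ε := by simpa using hσ
      have h := hcub_V0remCov τ hU hU' (bd p) (hor p hp).1 (hor p hp).2.1 (hor p hp).2.2.1 (hor p hp).2.2.2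
        (hε₀ p hp) hε4 B σ hσ0 hσ' hB
      simpa using h)
    (fun p _ B b hb X => V0remCov_add_single τ (bd p) hU hU' B hb X)
    hA0 (fun b => by simpa using norm_le_pi_norm A b) (by linarith) c
  simp only [one_pow, one_mul, mul_one] at hfree
  rw [sum_filter_sum_eq_sum_card Pl (fun p => bonds (bd p)) c (fun b => ‖A b‖)] at hfree
  -- assemble in the kernel form
  have hS : ∑ b ∈ Finset.univ.filter (fun b : ↥Λ => b.1.1 ∈ nbhdSites c.1.1 c.1.2), ‖A b‖ =
      ∑ b : ↥Λ, (if b.1.1 ∈ nbhdSites c.1.1 c.1.2 then 1 else 0) * ‖A b‖ := by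
    rw [Finset.sum_filter]
    refine Finset.sum_congr rfl fun b _ => ?_
    split_ifs <;> simp
  rw [hS] at hgrad
  calc ‖locGrad (cubT Λ Pl (Complex.I * η / 2) τ η U₀) A c
        + locGrad (fun A => ∑ p ∈ Pl, V0remCov τ (fun b : ↥Λ => U₀ b.1.1 b.1.2) (bd p) A) A c‖
      ≤ ‖locGrad (cubT Λ Pl (Complex.I * η / 2) τ η U₀) A c‖
        + ‖locGrad (fun A => ∑ p ∈ Pl, V0remCov τ (fun b : ↥Λ => U₀ b.1.1 b.1.2) (bd p) A) A c‖ := norm_add_le _ _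
    _ ≤ 144 * ((d : ℝ) - 1) * (η / 2) * ‖τ‖ * ‖Dv‖ * ‖A‖ *
          ∑ b : ↥Λ, (if b.1.1 ∈ nbhdSites c.1.1 c.1.2 then 1 else 0) * ‖A b‖
        + 8 * (‖τ‖ * (248 / 3 * ε₀ + 40 / 3 * ε)) * ‖A‖ *
          ∑ b : ↥Λ, ((Pl.filter (fun p => c ∈ bonds (bd p) ∧ b ∈ bonds (bd p))).card : ℝ) * ‖A b‖ :=
        add_le_add hgrad hfree
    _ = _ := by
        rw [Finset.mul_sum, Finset.mul_sum, Finset.mul_sum, ← Finset.sum_add_distrib]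
        refine Finset.sum_congr rfl fun b _ => ?_
        ring

/-- **S75 FIRES AT LEVEL 0: the pinned `Prop4Hyp` for OUR one-grid action.**  The located majorant of
`located_quad_ord₃_oneGrid` + flat differentiability (f5d-b `differentiable_sum_ord₃`) + the DISPLAYED pin geometry
(`ρ` with the one-sided Lipschitz pin `ϖ`, `δ′ ≥ 0`, positions `posIn`∕`posOut`) and row-sum bound
`Σ_b k₀ c b·e^{δ′ρ(posOut c, posIn b)} ≤ M` ⟹ `ShellMeasurePinnedProp4.prop4Hyp_pinned`:
`Prop4Hyp (Y ↦ (toPiL pin′).symm (locGrad (Σ_p ord₃ plaqFunSym_p) (toPiL pin Y))) M (ε∕2)` between the pinned spaces — S70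
f4's `hW` in the pinned currency INHABITED by our action at level 0.  [Balaban1985Variational] (98) TYPE; nothing printed
is asserted. [folklore] -/
theorem prop4Hyp_pinned_ord₃_oneGrid {η : ℝ} (hη : 0 < η) (htr : ∀ P Q : 𝔸, τ (P * Q) = τ (Q * P))
    (hincr : ∀ p ∈ Pl, p.1 < p.2.1) (hst : ∀ b : ↥Λ, plaqStar b.1.1 b.1.2 ⊆ Pl)
    (hbd : ∀ p ∈ Pl, ((bd p 0).1 : Site d × Fin d) = (p.2.2, p.1) ∧ ((bd p 1).1 : Site d × Fin d) = (p.2.2 + e p.1, p.2.1)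
      ∧ ((bd p 2).1 : Site d × Fin d) = (p.2.2 + e p.2.1, p.1) ∧ ((bd p 3).1 : Site d × Fin d) = (p.2.2, p.2.1))
    (hor : ∀ p ∈ Pl, (bd p 0).2 = true ∧ (bd p 1).2 = true ∧ (bd p 2).2 = false ∧ (bd p 3).2 = false)
    {I : Type*} [Fintype I] (Dv : (↥Λ → 𝔸) →L[ℂ] (I → 𝔸))
    (hDv : ∀ (A : ↥Λ → 𝔸) (y : Site d) (κ τ' : Fin d), ‖covDerivFwd η U₀ κ (fun z => ext Λ A z τ') y‖ ≤ ‖Dv A‖)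
    {ε₀ ε : ℝ} (hε : 0 < ε) (hε4 : 4 * ε ≤ 1) (hε₀0 : 0 ≤ ε₀)
    (hε₀ : ∀ p ∈ Pl, ‖(plaqWord (fun b : ↥Λ => U₀ b.1.1 b.1.2) (bd p) (0 : ↥Λ → 𝔸) : 𝔸) - 1‖ ≤ ε₀)
    {S : Type*} (ρ : S → S → ℝ) (posIn posOut : ↥Λ → S) (ϖ : S → ℝ) {δ' M : ℝ} (hδ' : 0 ≤ δ')
    (hϖ0 : ∀ x, 0 ≤ ϖ x) (hϖ : ∀ x y, ϖ x ≤ ϖ y + ρ x y) (hM0 : 0 ≤ M)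
    (hM : ∀ c : ↥Λ, ∑ b : ↥Λ,
      (72 * ((d : ℝ) - 1) * η * ‖τ‖ * ‖Dv‖ * (if b.1.1 ∈ nbhdSites c.1.1 c.1.2 then 1 else 0)
        + 8 * (‖τ‖ * (248 / 3 * ε₀ + 40 / 3 * ε)) *
          ((Pl.filter (fun p => c ∈ bonds (bd p) ∧ b ∈ bonds (bd p))).card : ℝ))
        * Real.exp (δ' * ρ (posOut c) (posIn b)) ≤ M) :
    Prop4Hyp (fun Y : WSup (pinW δ' (ϖ ∘ posIn)) 1 𝔸 =>
        ((WSup.toPiL (pinW δ' (ϖ ∘ posOut)) 1).symm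
          (locGrad (fun A => ∑ p ∈ Pl, ord₃ (plaqFunSym τ (fun b : ↥Λ => U₀ b.1.1 b.1.2) (bd p)) A)
            (WSup.toPiL (pinW δ' (ϖ ∘ posIn)) 1 Y)) : WSup (pinW δ' (ϖ ∘ posOut)) 1 (𝔸 →L[ℂ] ℂ))) M (ε / 2) := by
  refine prop4Hyp_pinned _ _ ρ posIn posOut ϖ hδ' hϖ0 hϖ (fun c b => ?_) (half_pos hε)
    (fun A hA c => located_quad_ord₃_oneGrid Λ Pl τ h₀ bd hη htr hincr hst hbd hor Dv hDv hε hε4 hε₀0 hε₀ A hA c) hM0 hM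
    (differentiableOn_locGrad_of_analyticOnNhd (Finset.analyticOnNhd_fun_sum Pl fun p _ A _ =>
      analyticAt_ord₃ (analyticAt_plaqFunSym (restr_unit_bounded Λ h₀).1 (restr_unit_bounded Λ h₀).2 τ (bd p) A)))
  -- the kernel is nonnegative
  have hd : 0 ≤ (d : ℝ) - 1 := by
    have : 1 ≤ d := Nat.succ_le_of_lt (Fin.pos c.1.2)
    have : (1 : ℝ) ≤ d := by exact_mod_cast this
    linarith
  have h1 : 0 ≤ (if b.1.1 ∈ nbhdSites c.1.1 c.1.2 then (1 : ℝ) else 0) := by split_ifs <;> norm_num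
  positivity

end Summit.QuantumFields.BalabanUV.T4Continuum.ShellMeasurePlaquetteCubicLocatedPinned

end
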